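import Summits.PneNP.PneNP.Theorems.SingleThreshold.Negative.LoadBearing
import Literature.Computability.Complexity.RossmanMonotoneCliqueCounting
import Literature.Computability.Complexity.GnpPlantedLikelihoodRatio

/-!
# A planted clique minus an edge is invisible in the subcritical random graph

Route `OneSlice`, crux `Summit.PneNP.PneNP.Theses.OneSlice.SingleThreshold` (stmt-PneNP-2833), line
`two-round-exposure`: the registered stub `stub_cliqueMinusEdgeInvisible`.

**What.** Fix `k ≥ 5` and `0 < ε ≤ k⁻³`, and let `S ∼ G(n, q)` with the subcritical sprinkle
density `q = pMinus k ε n = n^{-2(1+ε)/(k-1)}`, `A` a uniform `k`-set and `K_A = cliqueVec A`.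
Then there is `c₁ > 0` (here `c₁ = 1/(4(k-1))`) such that, eventually in `n`, for every MONOTONE
`f`, `Pr_{S,A}[f(S) = 0 ∧ ∃ e ∈ K_A, f(S ∪ (K_A − e)) = 1] ≤ n^{-c₁}`: planting a `k`-clique minus
an edge at a random position is invisible to every monotone test.

**How** (the second-moment / Cauchy–Schwarz template of Rossman 2010, App. B, Lemma 23, for the
planted family `Q_{A,e} = K_A − e`; the generic lemmas — planted likelihood ratios, Cauchy–Schwarz,
exponent bookkeeping — are in `Literature/Computability/Complexity/GnpPlantedLikelihoodRatio.lean`).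
* Union bound over the clique edge and monotonicity (`kSubsetProb_flipMinusEdge_le`): the
  indicator of the event is at most `Σ_{e ∈ K_A} (f(S ∪ Q_{A,e}) − f(S))`.
* Planting identity in likelihood-ratio form (`sum_gnpWeight_mul_sup_eq_sum_lr`):
  `E[g(S ∪ t)] = E[L_t(S) g(S)]`, `L_t(x) = q^{-e(t)} [t ⊆ x]`, with `E[L_t] = 1` and
  `E[L_t L_s] = q^{-e(t ∩ s)}`. Hence the averaged advantage is `(1/N) E[f · D]`,
  `D = Σ_{(A,e)} (L_{Q_{A,e}} − 1)`, `N = C(n,k)`, and by Cauchy–Schwarz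
  `E[f D]² ≤ E[D²] = Σ_{(A,e),(A',e')} (q^{-e(Q_{A,e} ∩ Q_{A',e'})} − 1)` (`sq_sum_adv_le`).
* Overlaps (`edgeCount_inf_update_le`): `e(Q_{A,e} ∩ Q_{A',e'}) ≤ min(C(|A ∩ A'|,2), C(k,2) − 1)`;
  pairs with `|A ∩ A'| ≤ 1` contribute `0`, the `k`-sets meeting `A` in `j` points are at most
  `C(k,j) k^j C(n,k) / n^j` (`card_filter_card_inter_le`), whence
  `E[D²] ≤ N² C(k,2)² Σ_{j ≤ k} C(k,j) k^j n^{-j} (q^{-min(C(j,2), C(k,2)-1)} − 1)`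
  (`secondMoment_pairs_le`); and for `ε ≤ k⁻³` every proper subgraph of `K_k` is strictly
  supercritical: `n^{-j} (q^{-min(…)} − 1) ≤ n^{-1/(k-1)}` (`rpow_overlap_le`). So
  `E[D²]/N² ≤ K₁(k) n^{-1/(k-1)}` and the advantage is `≤ n^{-1/(4(k-1))}` as soon as
  `K₁(k) ≤ n^{1/(2(k-1))}`.

## References

* B. Rossman, *The monotone complexity of k-clique on random graphs*, FOCS 2010, 193–201; SIAM J.
  Comput. 43 (2014) 256–279 — Appendix B, Lemma 23 (pp. 13–14), the second-moment template
  [Rossman2010]; the contiguity of a planted strictly-supercritical pattern is folklore.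
-/

noncomputable section

set_option linter.dupNamespace false

open Finset Filter

open scoped Classical Topology

namespace Summit.PneNP.PneNP.Theorems.SingleThreshold

open Literature.Computability.Complexity
open Summit.PneNP.PneNP.Theorems.SingleThreshold.Negative (Edges)

variable {n : ℕ}

/-! ### The union bound over the clique edge -/

/-- **Union bound over the missing edge** (monotone `f`): the indicator of
`{f(x) = 0 ∧ ∃ e ∈ K_A, f(x ∪ (K_A − e)) = 1}` is at most `Σ_{e ∈ K_A} (f(x ∪ (K_A − e)) − f(x))`,
every summand being nonnegative since `x ⊆ x ∪ (K_A − e)`. [folklore] -/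
theorem ite_flip_le_sum {f : (Edges n → Bool) → Bool} (hf : Monotone f) (x : Edges n → Bool)
    (A : Finset (Fin n)) :
    (if (f x = false ∧ ∃ e, cliqueVec A e = true ∧
        f (x ⊔ Function.update (cliqueVec A) e false) = true) then (1 : ℝ) else 0) ≤
      ∑ e ∈ univ.filter (fun e : Edges n => cliqueVec A e = true),
        ((if f (x ⊔ Function.update (cliqueVec A) e false) = true then (1 : ℝ) else 0) -
          (if f x = true then (1 : ℝ) else 0)) := by
  have hnn : ∀ e : Edges n,
      0 ≤ (if f (x ⊔ Function.update (cliqueVec A) e false) = true then (1 : ℝ) else 0) -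
        (if f x = true then (1 : ℝ) else 0) := by
    intro e
    by_cases hfx : f x = true
    · have h1 : f (x ⊔ Function.update (cliqueVec A) e false) = true := by
        have h := hf (le_sup_left : x ≤ x ⊔ Function.update (cliqueVec A) e false)
        rw [hfx] at h
        exact top_le_iff.1 h
      rw [if_pos h1, if_pos hfx, sub_self]
    · rw [if_neg hfx, sub_zero]
      split_ifs <;> norm_num
  by_cases h : (f x = false ∧ ∃ e, cliqueVec A e = true ∧
      f (x ⊔ Function.update (cliqueVec A) e false) = true)
  · rw [if_pos h]
    obtain ⟨hfx, e, he, hfe⟩ := h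
    have hfx' : ¬ f x = true := by rw [hfx]; exact Bool.false_ne_true
    calc (1 : ℝ) = (if f (x ⊔ Function.update (cliqueVec A) e false) = true then (1 : ℝ) else 0) -
          (if f x = true then (1 : ℝ) else 0) := by rw [if_pos hfe, if_neg hfx', sub_zero]
      _ ≤ _ := single_le_sum (s := univ.filter (fun e : Edges n => cliqueVec A e = true))
          (f := fun e => (if f (x ⊔ Function.update (cliqueVec A) e false) =
            true then (1 : ℝ) else 0) - (if f x = true then (1 : ℝ) else 0)) (fun e _ => hnn e)
          (mem_filter.2 ⟨mem_univ _, he⟩)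
  · rw [if_neg h]
    exact sum_nonneg fun e _ => hnn e

/-- **The averaged union bound**: `Pr_A[f(x) = 0 ∧ ∃ e ∈ K_A, f(x ∪ (K_A − e)) = 1] ≤
(1/C(n,k)) Σ_{(A,e)} (f(x ∪ (K_A − e)) − f(x))` for monotone `f`. [folklore] -/
theorem kSubsetProb_flipMinusEdge_le {k : ℕ} {f : (Edges n → Bool) → Bool} (hf : Monotone f)
    (x : Edges n → Bool) :
    kSubsetProb n k (fun A => f x = false ∧
        ∃ e, cliqueVec A e = true ∧ f (x ⊔ Function.update (cliqueVec A) e false) = true) ≤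
      (1 / (n.choose k : ℝ)) *
        ∑ p ∈ ((powersetCard k (univ : Finset (Fin n))) ×ˢ (univ : Finset (Edges n))).filter
            (fun p => cliqueVec p.1 p.2 = true),
          ((if f (x ⊔ Function.update (cliqueVec p.1) p.2 false) = true then (1 : ℝ) else 0) -
            (if f x = true then (1 : ℝ) else 0)) := by
  unfold kSubsetProb
  rw [natCast_card_filter, div_eq_mul_one_div, mul_comm]
  refine mul_le_mul_of_nonneg_left ?_ (by positivity)
  rw [sum_finset_product' (((powersetCard k (univ : Finset (Fin n))) ×ˢ
      (univ : Finset (Edges n))).filter (fun p => cliqueVec p.1 p.2 = true))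
      (powersetCard k (univ : Finset (Fin n)))
      (fun A => univ.filter fun e : Edges n => cliqueVec A e = true) mem_pairs_iff
      (f := fun A e => (if f (x ⊔ Function.update (cliqueVec A) e false) = true then (1 : ℝ)
        else 0) - (if f x = true then (1 : ℝ) else 0))]
  exact sum_le_sum fun A _ => ite_flip_le_sum hf x A

/-! ### Overlaps of two cliques minus an edge -/

/-- **Overlap of two cliques minus an edge.** For `e ∈ K_A`:
`e((K_A − e) ∩ (K_{A'} − e')) ≤ min(C(|A ∩ A'|, 2), C(|A|, 2) − 1)` (the common edges lie in
`K_{A ∩ A'}`, and in `K_A − e`, which has `C(|A|,2) − 1` edges). [folklore] -/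
theorem edgeCount_inf_update_le (A A' : Finset (Fin n)) {e : Edges n} (he : cliqueVec A e = true)
    (e' : Edges n) :
    edgeCount (Function.update (cliqueVec A) e false ⊓ Function.update (cliqueVec A') e' false) ≤
      min ((#(A ∩ A')).choose 2) ((#A).choose 2 - 1) := by
  change #(onSet (Function.update (cliqueVec A) e false ⊓
    Function.update (cliqueVec A') e' false)) ≤ _
  rw [onSet_inf]
  refine le_min ?_ ?_
  · calc #(onSet (Function.update (cliqueVec A) e false) ∩
          onSet (Function.update (cliqueVec A') e' false))
        ≤ #(onSet (cliqueVec (A ∩ A'))) := by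
          refine card_le_card fun d hd => ?_
          rw [mem_inter, mem_onSet, mem_onSet] at hd
          rw [mem_onSet, cliqueVec_eq_true_iff_endpts, subset_inter_iff,
            ← cliqueVec_eq_true_iff_endpts, ← cliqueVec_eq_true_iff_endpts]
          exact ⟨(le_iff_forall_imp _ _).1 (update_false_le _ e) d hd.1,
            (le_iff_forall_imp _ _).1 (update_false_le _ e') d hd.2⟩
      _ ≤ (#(A ∩ A')).choose 2 := card_onSet_cliqueVec_le _
  · calc #(onSet (Function.update (cliqueVec A) e false) ∩
          onSet (Function.update (cliqueVec A') e' false))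
        ≤ #(onSet (Function.update (cliqueVec A) e false)) := card_le_card inter_subset_left
      _ ≤ (#A).choose 2 - 1 := by
          have h1 := card_onSet_update_false (x := cliqueVec A) he
          have h2 := card_onSet_cliqueVec_le A
          omega

/-- **The `k`-sets meeting a fixed `k`-set `A` in exactly `j` points**: at most
`C(n,k) · C(k,j) k^j / n^j` of them (`k ≤ n`, `0 < n`; each is a superset of a `j`-subset of `A`,
`card_filter_supset_mul_pow_le`). [folklore] -/
theorem card_filter_card_inter_le {k : ℕ} (hkn : k ≤ n) (hn : 0 < n) {A : Finset (Fin n)}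
    (hA : #A = k) (j : ℕ) :
    (#((powersetCard k (univ : Finset (Fin n))).filter fun A' => #(A ∩ A') = j) : ℝ) ≤
      (n.choose k : ℝ) * ((k.choose j : ℝ) * (k : ℝ) ^ j / (n : ℝ) ^ j) := by
  have hsub : ((powersetCard k (univ : Finset (Fin n))).filter fun A' => #(A ∩ A') = j) ⊆
      (powersetCard j A).biUnion fun S =>
        (powersetCard k (univ : Finset (Fin n))).filter fun A' => S ⊆ A' := by
    intro A' hA'
    rw [mem_filter] at hA'
    rw [mem_biUnion]
    exact ⟨A ∩ A', mem_powersetCard.2 ⟨inter_subset_left, hA'.2⟩,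
      mem_filter.2 ⟨hA'.1, inter_subset_right⟩⟩
  have hnj : (0 : ℝ) < (n : ℝ) ^ j := by positivity
  rw [mul_div_assoc', le_div_iff₀ hnj]
  calc (#((powersetCard k (univ : Finset (Fin n))).filter fun A' => #(A ∩ A') = j) : ℝ) *
        (n : ℝ) ^ j
      ≤ ((∑ S ∈ powersetCard j A,
          #((powersetCard k (univ : Finset (Fin n))).filter fun A' => S ⊆ A') : ℕ) : ℝ) *
            (n : ℝ) ^ j := by
        refine mul_le_mul_of_nonneg_right ?_ hnj.le
        exact_mod_cast (card_le_card hsub).trans card_biUnion_le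
    _ = ∑ S ∈ powersetCard j A,
          ((#((powersetCard k (univ : Finset (Fin n))).filter fun A' => S ⊆ A') * n ^ j : ℕ) :
            ℝ) := by
        push_cast
        rw [sum_mul]
    _ ≤ ∑ S ∈ powersetCard j A, ((k ^ j * n.choose k : ℕ) : ℝ) := by
        refine sum_le_sum fun S hS => ?_
        have hSj : #S = j := (mem_powersetCard.1 hS).2
        have h := card_filter_supset_mul_pow_le hkn S
        rw [hSj] at h
        exact_mod_cast h
    _ = (n.choose k : ℝ) * ((k.choose j : ℝ) * (k : ℝ) ^ j) := by
        rw [sum_const, card_powersetCard, hA, nsmul_eq_mul]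
        push_cast
        ring

/-- Summing a nonnegative function of `|A ∩ A'|` over the `k`-sets `A'`, fibrewise. [folklore] -/
theorem sum_card_inter_le {k : ℕ} (hkn : k ≤ n) (hn : 0 < n) {A : Finset (Fin n)} (hA : #A = k)
    (U : ℕ → ℝ) (hU : ∀ j, 0 ≤ U j) :
    ∑ A' ∈ powersetCard k (univ : Finset (Fin n)), U (#(A ∩ A')) ≤
      (n.choose k : ℝ) *
        ∑ j ∈ range (k + 1), (k.choose j : ℝ) * (k : ℝ) ^ j / (n : ℝ) ^ j * U j := by
  have hmaps : ∀ A' ∈ powersetCard k (univ : Finset (Fin n)), #(A ∩ A') ∈ range (k + 1) :=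
    fun A' _ => mem_range.2 (Nat.lt_succ_of_le ((card_le_card inter_subset_left).trans hA.le))
  rw [← sum_fiberwise_of_maps_to hmaps, mul_sum]
  refine sum_le_sum fun j _ => ?_
  calc ∑ A' ∈ (powersetCard k (univ : Finset (Fin n))).filter (fun A' => #(A ∩ A') = j),
        U (#(A ∩ A'))
      = ∑ A' ∈ (powersetCard k (univ : Finset (Fin n))).filter (fun A' => #(A ∩ A') = j), U j :=
        sum_congr rfl fun A' hA' => by rw [(mem_filter.1 hA').2]
    _ = (#((powersetCard k (univ : Finset (Fin n))).filter fun A' => #(A ∩ A') = j) : ℝ) * U j := by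
        rw [sum_const, nsmul_eq_mul]
    _ ≤ (n.choose k : ℝ) * ((k.choose j : ℝ) * (k : ℝ) ^ j / (n : ℝ) ^ j) * U j :=
        mul_le_mul_of_nonneg_right (card_filter_card_inter_le hkn hn hA j) (hU j)
    _ = (n.choose k : ℝ) * ((k.choose j : ℝ) * (k : ℝ) ^ j / (n : ℝ) ^ j * U j) := by ring

/-- **The second-moment double sum over the pairs `(A,e), (A',e')`** is at most
`C(n,k)² C(k,2)² Σ_{j ≤ k} C(k,j) k^j n^{-j} (q^{-min(C(j,2), C(k,2)-1)} - 1)` (`0 < q ≤ 1`).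
[folklore] -/
theorem secondMoment_pairs_le {k : ℕ} (hkn : k ≤ n) (hn : 0 < n) {q : ℝ} (hq0 : 0 < q)
    (hq1 : q ≤ 1) :
    ∑ p ∈ ((powersetCard k (univ : Finset (Fin n))) ×ˢ (univ : Finset (Edges n))).filter
        (fun p => cliqueVec p.1 p.2 = true),
      ∑ p' ∈ ((powersetCard k (univ : Finset (Fin n))) ×ˢ (univ : Finset (Edges n))).filter
          (fun p => cliqueVec p.1 p.2 = true),
        ((q ^ edgeCount (Function.update (cliqueVec p.1) p.2 false ⊓
            Function.update (cliqueVec p'.1) p'.2 false))⁻¹ - 1) ≤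
      (n.choose k : ℝ) ^ 2 * (k.choose 2 : ℝ) ^ 2 *
        ∑ j ∈ range (k + 1), (k.choose j : ℝ) * (k : ℝ) ^ j / (n : ℝ) ^ j *
          ((q ^ min (j.choose 2) (k.choose 2 - 1))⁻¹ - 1) := by
  set 𝒜 := powersetCard k (univ : Finset (Fin n)) with h𝒜
  set P := (𝒜 ×ˢ (univ : Finset (Edges n))).filter (fun p => cliqueVec p.1 p.2 = true) with hP
  set U : ℕ → ℝ := fun j => (q ^ min (j.choose 2) (k.choose 2 - 1))⁻¹ - 1 with hU
  set S : ℝ := ∑ j ∈ range (k + 1), (k.choose j : ℝ) * (k : ℝ) ^ j / (n : ℝ) ^ j * U j with hS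
  have hU0 : ∀ j, 0 ≤ U j := fun j =>
    sub_nonneg.2 ((one_le_inv₀ (pow_pos hq0 _)).2 (pow_le_one₀ hq0.le hq1))
  have hfst : ∀ p ∈ P, #p.1 = k ∧ cliqueVec p.1 p.2 = true := fun p hp => by
    have h := (mem_pairs_iff p).1 hp
    exact ⟨(mem_powersetCard.1 h.1).2, (mem_filter.1 h.2).2⟩
  have hpt : ∀ p ∈ P, ∀ p' ∈ P,
      (q ^ edgeCount (Function.update (cliqueVec p.1) p.2 false ⊓
          Function.update (cliqueVec p'.1) p'.2 false))⁻¹ - 1 ≤ U (#(p.1 ∩ p'.1)) := by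
    intro p hp p' _
    obtain ⟨hpA, he⟩ := hfst p hp
    have hm := edgeCount_inf_update_le p.1 p'.1 he p'.2
    rw [hpA] at hm
    exact sub_le_sub_right (inv_anti₀ (pow_pos hq0 _) (pow_le_pow_of_le_one hq0.le hq1 hm)) 1
  have hinner : ∀ p ∈ P,
      ∑ p' ∈ P, ((q ^ edgeCount (Function.update (cliqueVec p.1) p.2 false ⊓
          Function.update (cliqueVec p'.1) p'.2 false))⁻¹ - 1) ≤
        (k.choose 2 : ℝ) * ((n.choose k : ℝ) * S) := by
    intro p hp
    obtain ⟨hpA, -⟩ := hfst p hp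
    calc _ ≤ ∑ p' ∈ P, U (#(p.1 ∩ p'.1)) := sum_le_sum (hpt p hp)
      _ = (k.choose 2 : ℝ) * ∑ A' ∈ 𝒜, U (#(p.1 ∩ A')) :=
          sum_pairs_eq (fun A' => U (#(p.1 ∩ A')))
      _ ≤ (k.choose 2 : ℝ) * ((n.choose k : ℝ) * S) :=
          mul_le_mul_of_nonneg_left (sum_card_inter_le hkn hn hpA U hU0) (Nat.cast_nonneg _)
  calc _ ≤ ∑ p ∈ P, (k.choose 2 : ℝ) * ((n.choose k : ℝ) * S) := sum_le_sum hinner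
    _ = (k.choose 2 : ℝ) * ∑ A ∈ 𝒜, (k.choose 2 : ℝ) * ((n.choose k : ℝ) * S) :=
        sum_pairs_eq (fun _ => (k.choose 2 : ℝ) * ((n.choose k : ℝ) * S))
    _ = (n.choose k : ℝ) ^ 2 * (k.choose 2 : ℝ) ^ 2 * S := by
        rw [sum_const, card_powersetCard, card_univ, Fintype.card_fin, nsmul_eq_mul]
        ring

/-! ### The stub -/

/-- **Stub B of line `two-round-exposure` — a planted clique minus an edge is invisible.** For
`k ≥ 5` and `0 < ε ≤ k⁻³` there is `c₁ > 0` (here `c₁ = 1/(4(k-1))`) such that eventually in `n`,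
for every MONOTONE `f`:
`Pr_{S,A}[f(S) = 0 ∧ ∃ e ∈ K_A, f(S ∪ (K_A − e)) = 1] ≤ n^{-c₁}`, where `S ∼ G(n, pMinus k ε n)`
and `A` is a uniform `k`-set. Proof: union bound over `e` and monotonicity
(`kSubsetProb_flipMinusEdge_le`), planting identity (`sum_gnpWeight_mul_sup_eq_sum_lr`),
Cauchy–Schwarz (`sq_sum_adv_le`), overlap count (`secondMoment_pairs_le`) and the exponent
bookkeeping `rpow_overlap_le`; the second-moment template of Rossman's Lemma 23.
[cite: Rossman2010, App. B, Lemma 23 (pp. 13–14)] -/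
theorem stub_cliqueMinusEdgeInvisible :
    ∀ k : ℕ, 5 ≤ k → ∀ ε : ℝ, 0 < ε → ε ≤ 1 / (k : ℝ) ^ 3 → ∃ c₁ : ℝ, 0 < c₁ ∧
      ∀ᶠ n : ℕ in atTop, ∀ f : (Edges n → Bool) → Bool, Monotone f →
        (∑ x : Edges n → Bool, gnpWeight n (pMinus k ε n) x *
            kSubsetProb n k (fun A => f x = false ∧
              ∃ e, cliqueVec A e = true ∧ f (x ⊔ Function.update (cliqueVec A) e false) = true))
          ≤ (n : ℝ) ^ (-c₁) := by
  intro k hk ε hε hεk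
  have hK : (5 : ℝ) ≤ k := by exact_mod_cast hk
  have hk1 : (0 : ℝ) < (k : ℝ) - 1 := by linarith
  refine ⟨1 / ((k : ℝ) - 1) / 4, by positivity, ?_⟩
  have hev : ∀ᶠ n : ℕ in atTop, (k.choose 2 : ℝ) ^ 2 * ((k + 1 : ℕ) : ℝ) * (2 ^ k * (k : ℝ) ^ k) ≤
      (n : ℝ) ^ (1 / ((k : ℝ) - 1) / 2) :=
    ((tendsto_rpow_atTop (by positivity)).comp tendsto_natCast_atTop_atTop).eventually_ge_atTop _
  filter_upwards [eventually_ge_atTop k, hev] with n hkn hK₁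
  intro f hf
  -- parameters at this `n`
  have hn : 0 < n := by omega
  have hn1' : 1 ≤ n := hn
  have hn0 : (0 : ℝ) < n := by exact_mod_cast hn
  set a : ℝ := 1 / ((k : ℝ) - 1) with ha
  set q : ℝ := pMinus k ε n with hqdef
  have hq0 : 0 < q := Real.rpow_pos_of_pos hn0 _
  have hq1 : q ≤ 1 := Real.rpow_le_one_of_one_le_of_nonpos (by exact_mod_cast hn1')
    (div_nonpos_of_nonpos_of_nonneg (neg_nonpos.2 (by positivity)) hk1.le)
  have hN0 : (0 : ℝ) < n.choose k := by exact_mod_cast Nat.choose_pos hkn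
  set P := ((powersetCard k (univ : Finset (Fin n))) ×ˢ (univ : Finset (Edges n))).filter
    (fun p => cliqueVec p.1 p.2 = true) with hP
  set S : ℝ := ∑ j ∈ range (k + 1), (k.choose j : ℝ) * (k : ℝ) ^ j / (n : ℝ) ^ j *
    ((q ^ min (j.choose 2) (k.choose 2 - 1))⁻¹ - 1) with hS
  -- Step 1: union bound over the missing edge, planting identity, exchange of sums
  have step1 : (∑ x : Edges n → Bool, gnpWeight n q x *
        kSubsetProb n k (fun A => f x = false ∧
          ∃ e, cliqueVec A e = true ∧ f (x ⊔ Function.update (cliqueVec A) e false) = true)) ≤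
      (1 / (n.choose k : ℝ)) * ∑ x, gnpWeight n q x * ((if f x = true then (1 : ℝ) else 0) *
        ∑ p ∈ P, (((q ^ edgeCount (Function.update (cliqueVec p.1) p.2 false))⁻¹ *
          if Function.update (cliqueVec p.1) p.2 false ≤ x then 1 else 0) - 1)) := by
    calc _ ≤ ∑ x : Edges n → Bool, gnpWeight n q x * ((1 / (n.choose k : ℝ)) *
          ∑ p ∈ P, ((if f (x ⊔ Function.update (cliqueVec p.1) p.2 false) = true then (1 : ℝ)
            else 0) - (if f x = true then (1 : ℝ) else 0))) :=
          sum_le_sum fun x _ => mul_le_mul_of_nonneg_left (kSubsetProb_flipMinusEdge_le hf x)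
            (gnpWeight_nonneg hq0.le hq1 x)
      _ = (1 / (n.choose k : ℝ)) * ∑ x : Edges n → Bool, gnpWeight n q x *
          ∑ p ∈ P, ((if f (x ⊔ Function.update (cliqueVec p.1) p.2 false) = true then (1 : ℝ)
            else 0) - (if f x = true then (1 : ℝ) else 0)) := by
          rw [mul_sum]
          exact sum_congr rfl fun x _ => by ring
      _ = _ := congrArg (fun t => (1 / (n.choose k : ℝ)) * t)
          (sum_mul_sum_sub_eq P (fun x => gnpWeight n q x)
            (fun x => if f x = true then (1 : ℝ) else 0)
            (fun p x => if f (x ⊔ Function.update (cliqueVec p.1) p.2 false) = true then (1 : ℝ)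
              else 0)
            (fun p x => (q ^ edgeCount (Function.update (cliqueVec p.1) p.2 false))⁻¹ *
              if Function.update (cliqueVec p.1) p.2 false ≤ x then 1 else 0)
            (fun p _ => sum_gnpWeight_mul_sup_eq_sum_lr hq0.ne'
              (Function.update (cliqueVec p.1) p.2 false)
              (fun x => if f x = true then (1 : ℝ) else 0)))
  -- Step 2: Cauchy–Schwarz and the second moment of the planted likelihood ratio
  have hcore := sq_sum_adv_le P (fun p => Function.update (cliqueVec p.1) p.2 false) hq0 hq1
    (fun x => f x = true)
  have hpairs : ∑ p ∈ P, ∑ p' ∈ P, ((q ^ edgeCount (Function.update (cliqueVec p.1) p.2 false ⊓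
      Function.update (cliqueVec p'.1) p'.2 false))⁻¹ - 1) ≤
      (n.choose k : ℝ) ^ 2 * (k.choose 2 : ℝ) ^ 2 * S := secondMoment_pairs_le hkn hn hq0 hq1
  -- Step 3: every term of `S` is `≤ 2^k k^k n^{-a}`
  have hSle : S ≤ ((k + 1 : ℕ) : ℝ) * (2 ^ k * (k : ℝ) ^ k * (n : ℝ) ^ (-a)) := by
    calc S ≤ ∑ j ∈ range (k + 1), (2 ^ k * (k : ℝ) ^ k * (n : ℝ) ^ (-a)) := by
          refine sum_le_sum fun j hj => ?_
          have hjk : j ≤ k := Nat.lt_succ_iff.1 (mem_range.1 hj)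
          have h1 := rpow_overlap_le (n := n) hk hε hεk hn1' hjk
          have h2 : (k.choose j : ℝ) ≤ 2 ^ k := by exact_mod_cast Nat.choose_le_two_pow k j
          have h3 : (k : ℝ) ^ j ≤ (k : ℝ) ^ k := pow_le_pow_right₀ (by linarith) hjk
          have hU0 : 0 ≤ (q ^ min (j.choose 2) (k.choose 2 - 1))⁻¹ - 1 :=
            sub_nonneg.2 ((one_le_inv₀ (pow_pos hq0 _)).2 (pow_le_one₀ hq0.le hq1))
          calc (k.choose j : ℝ) * (k : ℝ) ^ j / (n : ℝ) ^ j *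
                ((q ^ min (j.choose 2) (k.choose 2 - 1))⁻¹ - 1)
              = ((k.choose j : ℝ) * (k : ℝ) ^ j) *
                  (((n : ℝ) ^ j)⁻¹ * ((q ^ min (j.choose 2) (k.choose 2 - 1))⁻¹ - 1)) := by ring
            _ ≤ (2 ^ k * (k : ℝ) ^ k) * (n : ℝ) ^ (-a) :=
                mul_le_mul (mul_le_mul h2 h3 (by positivity) (by positivity)) h1
                  (mul_nonneg (by positivity) hU0) (by positivity)
            _ = 2 ^ k * (k : ℝ) ^ k * (n : ℝ) ^ (-a) := by ring
      _ = ((k + 1 : ℕ) : ℝ) * (2 ^ k * (k : ℝ) ^ k * (n : ℝ) ^ (-a)) := by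
          rw [sum_const, card_range, nsmul_eq_mul]
  -- Step 4: assemble
  have hLHS0 : 0 ≤ ∑ x : Edges n → Bool, gnpWeight n q x *
      kSubsetProb n k (fun A => f x = false ∧
        ∃ e, cliqueVec A e = true ∧ f (x ⊔ Function.update (cliqueVec A) e false) = true) :=
    sum_nonneg fun x _ => mul_nonneg (gnpWeight_nonneg hq0.le hq1 x) (kSubsetProb_nonneg _ _ _)
  refine step1.trans ((sq_le_sq₀ (hLHS0.trans step1) (Real.rpow_nonneg hn0.le _)).1 ?_)
  rw [mul_pow]
  calc (1 / (n.choose k : ℝ)) ^ 2 * (∑ x, gnpWeight n q x * ((if f x = true then (1 : ℝ) else 0) *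
        ∑ p ∈ P, (((q ^ edgeCount (Function.update (cliqueVec p.1) p.2 false))⁻¹ *
          if Function.update (cliqueVec p.1) p.2 false ≤ x then 1 else 0) - 1))) ^ 2
      ≤ (1 / (n.choose k : ℝ)) ^ 2 * ((n.choose k : ℝ) ^ 2 * (k.choose 2 : ℝ) ^ 2 * S) :=
        mul_le_mul_of_nonneg_left (hcore.trans hpairs) (sq_nonneg _)
    _ = (k.choose 2 : ℝ) ^ 2 * S := by field_simp
    _ ≤ (k.choose 2 : ℝ) ^ 2 * (((k + 1 : ℕ) : ℝ) * (2 ^ k * (k : ℝ) ^ k * (n : ℝ) ^ (-a))) :=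
        mul_le_mul_of_nonneg_left hSle (sq_nonneg _)
    _ = (k.choose 2 : ℝ) ^ 2 * ((k + 1 : ℕ) : ℝ) * (2 ^ k * (k : ℝ) ^ k) * (n : ℝ) ^ (-a) := by ring
    _ ≤ (n : ℝ) ^ (a / 2) * (n : ℝ) ^ (-a) :=
        mul_le_mul_of_nonneg_right hK₁ (Real.rpow_nonneg hn0.le _)
    _ = ((n : ℝ) ^ (-(a / 4))) ^ 2 := by
        rw [← Real.rpow_add hn0, ← Real.rpow_natCast, ← Real.rpow_mul hn0.le]
        congr 1
        push_cast
        ring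

end Summit.PneNP.PneNP.Theorems.SingleThreshold

end
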